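import Mathlib
import HarnessLib
import Summits.ValiantsHypothesis.ValiantsHypothesis.Theses.MonotoneRestoration
import Literature.Computability.AlgebraicComplexity.ArithCircuit
import Literature.Computability.AlgebraicComplexity.ArithCircuitProofs
import Literature.Computability.AlgebraicComplexity.MonotoneStructure
import Literature.Computability.AlgebraicComplexity.PermanentIrreducible
import Literature.ModelTheory.FiniteModelTheory.CkEquiv
import Summits.ValiantsHypothesis.ValiantsHypothesis.Theorems.MonotoneRestorationMonotoneRestorationQPCosetCount
import Summits.ValiantsHypothesis.ValiantsHypothesis.Theorems.MonotoneRestorationMonotoneRestorationQPSymmetricLB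
import Summits.ValiantsHypothesis.ValiantsHypothesis.Theorems.MonotoneRestorationMonotoneRestorationQPSupportSymmetrisation
import Summits.ValiantsHypothesis.ValiantsHypothesis.Theorems.MonotoneRestorationMonotoneRestorationQPSparseRegime
import Summits.ValiantsHypothesis.ValiantsHypothesis.Theorems.MonotoneRestorationMonotoneRestorationQPBeta
import Literature.Computability.AlgebraicComplexity.SymmetricArithCircuit
import Literature.Computability.AlgebraicComplexity.DawarWilsenach2025Proofs
import Literature.GroupTheory.PermutationGroups.SmallIndexSubgroups
import Summits.ValiantsHypothesis.ValiantsHypothesis.Theorems.MonotoneRestorationQP.Negative.LoadBearing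
import Summits.ValiantsHypothesis.ValiantsHypothesis.Theorems.MonotoneRestorationMonotoneRestorationQPPermSupportCount

/-! TTRL-lite variant V19962 of stmt-ValiantsHypothesis-15886 -/

set_option linter.dupNamespace false

namespace Summit.ValiantsHypothesis.ValiantsHypothesis.Theorems

open Summit.ValiantsHypothesis.ValiantsHypothesis.Theses.MonotoneRestoration
open Literature.Computability.AlgebraicComplexity

set_option linter.unusedVariables false in
/-- TTRL-lite variant V19962 (`small_case`: an arbitrary EMPTY index type `σ`, exact size `0`) of
`stub_monotoneComputation_of_complexity` (stmt-ValiantsHypothesis-15886), the outward push of the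
proved corners V18982/V19021 (`σ := Fin 0`): when `σ` is empty every `f : MvPolynomial σ ℝ≥0` is
the constant `C (coeff 0 f)` (`MvPolynomial.eq_C_of_isEmpty`), and the gate-free circuit
`ArithCircuit.ofConst c` is a Jerrum–Snir monotone computation of `C c` of size exactly `0`
(`isMonotoneComputation_ofConst`: constants are free inputs).  The instance binder carries the
name `inst` of the machine-generated variant statement (kept verbatim), whence the scoped
`unusedVariables` exemption. [cite: JerrumSnir1982, §2.2] -/
theorem stub_monotoneComputation_of_complexity_var19962 :
    ∀ (σ : Type) [inst : IsEmpty σ] (f : MvPolynomial σ NNReal), ∃ P : ArithCircuit NNReal σ,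
      Literature.Barriers.ValiantsHypothesis.IsMonotoneComputation P f ∧ P.size = 0 := by
  intro σ _ f
  obtain ⟨c, rfl⟩ : ∃ c : NNReal, f = MvPolynomial.C c := ⟨_, MvPolynomial.eq_C_of_isEmpty f⟩
  exact ⟨ArithCircuit.ofConst c,
    (Literature.Barriers.ValiantsHypothesis.isMonotoneComputation_ofConst c).1,
    (Literature.Barriers.ValiantsHypothesis.isMonotoneComputation_ofConst c).2⟩

end Summit.ValiantsHypothesis.ValiantsHypothesis.Theorems
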